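import Literature.Barriers.Parity.SiegelZeroDichotomyPairHLTypeIModel
import HarnessLib

/-!
# Tao–Teräväinen 2022, §8 (`k = 2`): the three-term expansion of `(χ∗log)♯`

Topic `Literature/Barriers/Parity`, sub-namespace `TaoTeravainen`; first file of step (v) of the
proof DAG of `Literature.Barriers.Parity.TaoTeravainen2021_prop72_81_pair` (T. Tao, J. Teräväinen,
*The Hardy–Littlewood–Chowla conjecture in the presence of a Siegel zero*, J. London Math. Soc. (2)
106 (2022), arXiv:2109.06291), §8: "we see from (7.2) … that
`(χ∗log)♯(n) = ∫_{1/100}^{Dq²} ∑_{d∣n} Φ_t(d) χ(n/d) log t dt/t + ∫_{Dq²}^{100x} ψ_{≤(Dq²)²}(x/t) ∑ Φ_t(n/d)χ(d) log t dt/t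
+ ∫ ψ_{>(Dq²)²}(x/t) ∑ Φ_{Dq²}(d)χ(n/d) log t dt/t` … One can then write
`(χ∗log)♯(n) = ∑_{d ≪ (Dq²)²: d∣n} (Ψ(n/d) χ(d) + c_d χ(n/d))`, where
`Ψ(y) := ∫_{Dq²}^{100x} ψ_{≤(Dq²)²}(x/t) Φ_t(y) log t dt/t` and `c_d := ∫_{1/100}^{Dq²} Φ_t(d) log t dt/t
+ ∫ ψ_{>(Dq²)²}(x/t) Φ_{Dq²}(d) log t dt/t` … we will need the crude bound `‖Ψ‖_TV ≪ log^{O(1)} x`,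
`c_d ≪ log^{O(1)} x`." Everything here is PROVED, in the variable `u = log t` of
`SiegelZeroDichotomyPairHLTypeIModel.lean` (`X = log x`, `U₀ = log(Dq²)`):

* `sharpWeight ψ X U₀ u = ψ((X-u)/(2U₀))` (`= ψ_{≤(Dq²)²}(x/t)`), `psiSharp` (`Ψ`), `sharpLogCoeff`
  (`c_b`, with the `P(U₀) Φ_{Dq²}` term of our rendering of (7.3));
* **`sharpLog_eq_sum`** — `(χ∗log)♯(n) = ∑_{db = n} χ(d) (c_b + Ψ(b))` for `1 ≤ n` with
  `log n ≤ X + U₀ - 1` (`2 ≤ U₀`, `2U₀ ≤ X`);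
* support and size: `sharpLogCoeff_eq_zero` (`c_b = 0` for `log b ≥ U₀ + 1`), `abs_sharpLogCoeff_le`,
  `psiSharp_eq_zero` (`Ψ(y) = 0` for `log y ≤ X - 2U₀ - 1`), `abs_psiSharp_le`, and
  `psiSharp_eq_log` (`Ψ(y) = log y` once `X - U₀ + 1 ≤ log y ≤ X + U₀ - 1`).
  [cite: TaoTeravainen2021, §8 (the expansion of `(χ∗log)♯` and the bounds for `Ψ`, `c_d`)]
-/

noncomputable section

open Finset Real MeasureTheory Set
open scoped ContDiff Topology

namespace Literature.Barriers.Parity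

namespace TaoTeravainen

variable {q : ℕ}

/-! ### The objects -/

/-- `w♯(u) := ψ((X - u)/(2U₀))` (`= ψ_{≤(Dq²)²}(x/t)` in the variable `u = log t`).
[cite: TaoTeravainen2021, §8 (the weight `ψ_{≤(Dq_χ²)²}(x/t)`)] -/
def sharpWeight (ψ : ℝ → ℝ) (X U₀ u : ℝ) : ℝ := ψ ((X - u) / (2 * U₀))

/-- `Ψ(y) := ∫_{u > U₀} w♯(u) φ(log y - u) u du`. [cite: TaoTeravainen2021, §8 (definition of `Ψ`)] -/
def psiSharp (φ ψ : ℝ → ℝ) (X U₀ y : ℝ) : ℝ :=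
  ∫ u in Ioi U₀, sharpWeight ψ X U₀ u * φ (Real.log y - u) * u

/-- `c_b := ∫_{u ≤ U₀} φ(log b - u) u du + P(U₀) φ(log b - U₀)`. [cite: TaoTeravainen2021, §8
(definition of `c_d`)] -/
def sharpLogCoeff (φ ψ : ℝ → ℝ) (X U₀ : ℝ) (b : ℕ) : ℝ :=
  (∫ u in Iic U₀, φ (Real.log b - u) * u) + flatKernel ψ X U₀ U₀ * φ (Real.log b - U₀)

/-! ### Integrability -/

/-- `u ↦ g(u) φ(c - u) u` is integrable on any set for bounded measurable... we only need: for
continuous compactly supported `φ` and `|w| ≤ B` measurable, `u ↦ w(u) φ(c-u) u` is integrable.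
[folklore] -/
theorem integrable_weight_mul_bump {φ : ℝ → ℝ} (hφ : IsBump φ) {w : ℝ → ℝ} (hwm : AEStronglyMeasurable w volume)
    {B : ℝ} (hw : ∀ u, |w u| ≤ B) (c : ℝ) :
    Integrable fun u => w u * φ (c - u) * u := by
  have h1 : Integrable fun u : ℝ => φ (c - u) * u := hφ.integrable_sub_left_mul c
  have h2 : Integrable fun u : ℝ => w u * (φ (c - u) * u) := by
    refine h1.bdd_mul (c := B) hwm (Filter.Eventually.of_forall fun u => ?_)
    rw [Real.norm_eq_abs]; exact hw u
  exact h2.congr (Filter.Eventually.of_forall fun u => by ring)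

/-! ### Support and size of `c_b` and `Ψ` -/

/-- `c_b = 0` once `log b ≥ U₀ + 1`. [cite: TaoTeravainen2021, §8 ("the summands vanish unless
`d ≪ (Dq²)²`")] -/
theorem sharpLogCoeff_eq_zero {φ : ℝ → ℝ} (hφ : IsBump φ) (ψ : ℝ → ℝ) (X : ℝ) {U₀ : ℝ} {b : ℕ}
    (hb : U₀ + 1 ≤ Real.log b) : sharpLogCoeff φ ψ X U₀ b = 0 := by
  unfold sharpLogCoeff
  rw [hφ.eq_zero _ (by rw [abs_of_nonneg (by linarith)]; linarith), mul_zero, add_zero]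
  refine setIntegral_eq_zero_of_forall_eq_zero fun u hu => ?_
  rw [Set.mem_Iic] at hu
  rw [hφ.eq_zero _ (by rw [abs_of_nonneg (by linarith)]; linarith), zero_mul]

/-- `Ψ(y) = 0` once `log y ≤ X - 2U₀ - 1` (`U₀ > 0`). [cite: TaoTeravainen2021, §8] -/
theorem psiSharp_eq_zero {φ ψ : ℝ → ℝ} (hφ : IsBump φ) (hψ : IsSmoothCutoff ψ) {X U₀ : ℝ}
    (hU₀ : 0 < U₀) {y : ℝ} (hy : Real.log y ≤ X - 2 * U₀ - 1) : psiSharp φ ψ X U₀ y = 0 := by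
  unfold psiSharp
  refine setIntegral_eq_zero_of_forall_eq_zero fun u _ => ?_
  by_cases hu : u ≤ X - 2 * U₀
  · -- `w♯(u) = ψ(≥ 1) = 0`
    unfold sharpWeight
    rw [hψ.eq_zero _ ?_, zero_mul, zero_mul]
    rw [abs_of_nonneg (div_nonneg (by linarith) (by linarith)), le_div_iff₀ (by linarith)]
    linarith
  · push Not at hu
    rw [hφ.eq_zero _ (by rw [abs_of_nonpos (by linarith)]; linarith), mul_zero, zero_mul]

/-- `|w♯| ≤ sup|ψ|`. [folklore] -/
theorem abs_sharpWeight_le {ψ : ℝ → ℝ} {Bψ : ℝ} (hBψ : ∀ u, |ψ u| ≤ Bψ) (X U₀ u : ℝ) :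
    |sharpWeight ψ X U₀ u| ≤ Bψ := hBψ _

/-- `|c_b| ≤ sup|φ| (2 (U₀ + 2) + (1 + sup|ψ|) X²)` for `b ≥ 1`, `0 < U₀`, `2U₀ ≤ X`
("`c_d ≪ log^{O(1)} x`"). [cite: TaoTeravainen2021, §8] -/
theorem abs_sharpLogCoeff_le {φ ψ : ℝ → ℝ} (hφ : IsBump φ) {B₀ Bψ : ℝ} (hB₀ : ∀ u, |φ u| ≤ B₀)
    (hBψ : ∀ u, |ψ u| ≤ Bψ) {X U₀ : ℝ} (hU₀ : 0 < U₀) (hX : 2 * U₀ ≤ X) {b : ℕ} (hb : 1 ≤ b) :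
    |sharpLogCoeff φ ψ X U₀ b| ≤ B₀ * (2 * (U₀ + 2) + (1 + Bψ) * X ^ 2) := by
  have hB₀0 : 0 ≤ B₀ := (abs_nonneg _).trans (hB₀ 0)
  have hBψ0 : 0 ≤ 1 + Bψ := by linarith [(abs_nonneg _).trans (hBψ 0)]
  have hlogb : 0 ≤ Real.log b := Real.log_nonneg (by exact_mod_cast hb)
  have hX0 : 0 ≤ X := by linarith
  unfold sharpLogCoeff
  -- the integral: the integrand vanishes off `[log b - 1, log b + 1] ∩ (-∞, U₀]`, where `|u| ≤ U₀ + 2`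
  have h1 : |∫ u in Iic U₀, φ (Real.log b - u) * u| ≤ B₀ * (2 * (U₀ + 2)) := by
    -- restrict to the window `[log b - 1, min U₀ (log b + 1)]`
    have hsupp : ∀ u, u ∉ Icc (Real.log b - 1) (Real.log b + 1) → φ (Real.log b - u) * u = 0 := by
      intro u hu
      rw [hφ.eq_zero_of_notMem ?_, zero_mul]
      intro h; apply hu; rw [Set.mem_Icc] at h ⊢; constructor <;> linarith [h.1, h.2]
    by_cases hcase : Real.log b - 1 ≤ U₀
    · have hint : ∫ u in Iic U₀, φ (Real.log b - u) * u =
          ∫ u in Iic U₀ ∩ Icc (Real.log b - 1) (Real.log b + 1), φ (Real.log b - u) * u := by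
        rw [← setIntegral_indicator measurableSet_Icc]
        refine setIntegral_congr_fun measurableSet_Iic fun u _ => ?_
        by_cases h : u ∈ Icc (Real.log b - 1) (Real.log b + 1)
        · rw [indicator_of_mem h]
        · rw [indicator_of_notMem h, hsupp u h]
      rw [hint]
      have hvol : volume (Iic U₀ ∩ Icc (Real.log b - 1) (Real.log b + 1)) < ⊤ :=
        lt_of_le_of_lt (measure_mono inter_subset_right) (by rw [Real.volume_Icc]; exact ENNReal.ofReal_lt_top)
      have hbound : ∀ u ∈ Iic U₀ ∩ Icc (Real.log b - 1) (Real.log b + 1), ‖φ (Real.log b - u) * u‖ ≤ B₀ * (U₀ + 2) := by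
        intro u hu
        rw [Set.mem_inter_iff, Set.mem_Iic, Set.mem_Icc] at hu
        rw [Real.norm_eq_abs, abs_mul]
        refine mul_le_mul (hB₀ _) ?_ (abs_nonneg _) hB₀0
        rw [abs_le]; constructor <;> linarith [hu.2.1, hu.1]
      have h := norm_setIntegral_le_of_norm_le_const hvol hbound
      rw [Real.norm_eq_abs] at h
      refine h.trans ?_
      have hvol2 : volume.real (Iic U₀ ∩ Icc (Real.log b - 1) (Real.log b + 1)) ≤ 2 := by
        rw [measureReal_def]
        calc (volume (Iic U₀ ∩ Icc (Real.log b - 1) (Real.log b + 1))).toReal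
            ≤ (volume (Icc (Real.log b - 1) (Real.log b + 1))).toReal :=
              ENNReal.toReal_mono (by rw [Real.volume_Icc]; exact ENNReal.ofReal_ne_top)
                (measure_mono inter_subset_right)
          _ = 2 := by rw [Real.volume_Icc, ENNReal.toReal_ofReal (by linarith)]; ring
      have : 0 ≤ B₀ * (U₀ + 2) := by positivity
      nlinarith
    · -- empty window: the integral vanishes
      push Not at hcase
      rw [setIntegral_eq_zero_of_forall_eq_zero fun u hu => hsupp u (by
        rw [Set.mem_Iic] at hu; intro h; rw [Set.mem_Icc] at h; linarith [h.1])]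
      rw [abs_zero]; positivity
  have h2 : |flatKernel ψ X U₀ U₀ * φ (Real.log b - U₀)| ≤ B₀ * ((1 + Bψ) * X ^ 2) := by
    rw [abs_mul]
    have hP := abs_flatKernel_le hBψ (X := X) (U₀ := U₀) (v := U₀) hU₀.le (by linarith)
    have hXU0 : 0 ≤ X - U₀ := by linarith
    calc |flatKernel ψ X U₀ U₀| * |φ (Real.log b - U₀)| ≤ ((1 + Bψ) * X * (X - U₀)) * B₀ :=
          mul_le_mul hP (hB₀ _) (abs_nonneg _) (by positivity)
      _ ≤ ((1 + Bψ) * X * X) * B₀ := by gcongr; linarith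
      _ = B₀ * ((1 + Bψ) * X ^ 2) := by ring
  calc |(∫ u in Iic U₀, φ (Real.log b - u) * u) + flatKernel ψ X U₀ U₀ * φ (Real.log b - U₀)|
      ≤ |∫ u in Iic U₀, φ (Real.log b - u) * u| + |flatKernel ψ X U₀ U₀ * φ (Real.log b - U₀)| := abs_add_le _ _
    _ ≤ B₀ * (2 * (U₀ + 2)) + B₀ * ((1 + Bψ) * X ^ 2) := add_le_add h1 h2
    _ = _ := by ring

/-- `|Ψ(y)| ≤ 2 sup|ψ| sup|φ| (|log y| + 1)`. [cite: TaoTeravainen2021, §8 ("`‖Ψ‖_TV ≪ log^{O(1)} x`")] -/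
theorem abs_psiSharp_le {φ ψ : ℝ → ℝ} (hφ : IsBump φ) {B₀ Bψ : ℝ} (hB₀ : ∀ u, |φ u| ≤ B₀)
    (hBψ : ∀ u, |ψ u| ≤ Bψ) (X U₀ y : ℝ) :
    |psiSharp φ ψ X U₀ y| ≤ 2 * Bψ * B₀ * (|Real.log y| + 1) := by
  have hB₀0 : 0 ≤ B₀ := (abs_nonneg _).trans (hB₀ 0)
  have hBψ0 : 0 ≤ Bψ := (abs_nonneg _).trans (hBψ 0)
  unfold psiSharp
  set c := Real.log y with hc
  have hsupp : ∀ u, u ∉ Icc (c - 1) (c + 1) → sharpWeight ψ X U₀ u * φ (c - u) * u = 0 := by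
    intro u hu
    rw [hφ.eq_zero_of_notMem ?_, mul_zero, zero_mul]
    intro h; apply hu; rw [Set.mem_Icc] at h ⊢; constructor <;> linarith [h.1, h.2]
  have hint : ∫ u in Ioi U₀, sharpWeight ψ X U₀ u * φ (c - u) * u =
      ∫ u in Ioi U₀ ∩ Icc (c - 1) (c + 1), sharpWeight ψ X U₀ u * φ (c - u) * u := by
    rw [← setIntegral_indicator measurableSet_Icc]
    refine setIntegral_congr_fun measurableSet_Ioi fun u _ => ?_
    by_cases h : u ∈ Icc (c - 1) (c + 1)
    · rw [indicator_of_mem h]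
    · rw [indicator_of_notMem h, hsupp u h]
  rw [hint]
  have hvol : volume (Ioi U₀ ∩ Icc (c - 1) (c + 1)) < ⊤ :=
    lt_of_le_of_lt (measure_mono inter_subset_right) (by rw [Real.volume_Icc]; exact ENNReal.ofReal_lt_top)
  have hbound : ∀ u ∈ Ioi U₀ ∩ Icc (c - 1) (c + 1), ‖sharpWeight ψ X U₀ u * φ (c - u) * u‖ ≤ Bψ * B₀ * (|c| + 1) := by
    intro u hu
    rw [Set.mem_inter_iff, Set.mem_Icc] at hu
    rw [Real.norm_eq_abs, abs_mul, abs_mul]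
    refine mul_le_mul (mul_le_mul (abs_sharpWeight_le hBψ X U₀ u) (hB₀ _) (abs_nonneg _) hBψ0) ?_
      (abs_nonneg _) (by positivity)
    calc |u| = |c + (u - c)| := by ring_nf
      _ ≤ |c| + |u - c| := abs_add_le _ _
      _ ≤ |c| + 1 := by gcongr; rw [abs_le]; constructor <;> linarith [hu.2.1, hu.2.2]
  have h := norm_setIntegral_le_of_norm_le_const hvol hbound
  rw [Real.norm_eq_abs] at h
  refine h.trans ?_
  have hvol2 : volume.real (Ioi U₀ ∩ Icc (c - 1) (c + 1)) ≤ 2 := by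
    rw [measureReal_def]
    calc (volume (Ioi U₀ ∩ Icc (c - 1) (c + 1))).toReal ≤ (volume (Icc (c - 1) (c + 1))).toReal :=
          ENNReal.toReal_mono (by rw [Real.volume_Icc]; exact ENNReal.ofReal_ne_top) (measure_mono inter_subset_right)
      _ = 2 := by rw [Real.volume_Icc, ENNReal.toReal_ofReal (by linarith)]; ring
  have : 0 ≤ Bψ * B₀ * (|c| + 1) := by positivity
  nlinarith

/-- **`Ψ(y) = log y` in the bulk**: for `X - U₀ + 1 ≤ log y ≤ X + U₀ - 1` (there `w♯ ≡ 1` on the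
support of `φ(log y - ·)`), `0 < U₀`, `2U₀ ≤ X`. [cite: TaoTeravainen2021, proof of Lemma 8.2
("`ψ(log(x/t)/(2 log Dq²))` equals to `1` on the support of `φ'(log((y+h_j)/t))`")] -/
theorem psiSharp_eq_log {φ ψ : ℝ → ℝ} (hφ : IsBump φ) (hψ : IsSmoothCutoff ψ) {X U₀ : ℝ}
    (hU₀ : 0 < U₀) (hXU : 2 * U₀ ≤ X) {y : ℝ} (hy₁ : X - U₀ + 1 ≤ Real.log y) (hy₂ : Real.log y ≤ X + U₀ - 1) :
    psiSharp φ ψ X U₀ y = Real.log y := by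
  unfold psiSharp
  set c := Real.log y with hc
  -- on `u > U₀` with `φ(c - u) ≠ 0` one has `|X - u| ≤ U₀`, so `w♯(u) = 1`
  have h1 : ∫ u in Ioi U₀, sharpWeight ψ X U₀ u * φ (c - u) * u = ∫ u in Ioi U₀, φ (c - u) * u := by
    refine setIntegral_congr_fun measurableSet_Ioi fun u _ => ?_
    by_cases h : u ∈ Icc (c - 1) (c + 1)
    · rw [Set.mem_Icc] at h
      unfold sharpWeight
      rw [hψ.eq_one _ ?_, one_mul]
      rw [abs_le]; constructor
      · rw [le_div_iff₀ (by linarith)]; linarith [h.2]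
      · rw [div_le_iff₀ (by linarith)]; linarith [h.1]
    · rw [hφ.eq_zero_of_notMem ?_, mul_zero, zero_mul]
      intro h'; apply h; rw [Set.mem_Icc] at h' ⊢; constructor <;> linarith [h'.1, h'.2]
  -- and the integrand vanishes for `u ≤ U₀` (`c - u ≥ X - 2U₀ + 1 > 1`)
  have h2 : ∫ u in Iic U₀, φ (c - u) * u = 0 := by
    refine setIntegral_eq_zero_of_forall_eq_zero fun u hu => ?_
    rw [Set.mem_Iic] at hu
    rw [hφ.eq_zero _ (by rw [abs_of_nonneg (by linarith)]; linarith), zero_mul]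
  rw [h1]
  have hsplit := intervalIntegral.integral_Iic_add_Ioi (f := fun u => φ (c - u) * u) (b := U₀)
    (hφ.integrable_sub_left_mul c).integrableOn (hφ.integrable_sub_left_mul c).integrableOn
  rw [h2, zero_add, hφ.integral_sub_left_mul] at hsplit
  exact hsplit

/-! ### The three-term expansion -/

/-- `∫_{u > a} F = ∫_a^T F` when `F` vanishes beyond `T ≥ a`. [folklore] -/
theorem setIntegral_Ioi_eq_intervalIntegral {F : ℝ → ℝ} {a T : ℝ} (haT : a ≤ T)
    (hF : ∀ u, T < u → F u = 0) : ∫ u in Ioi a, F u = ∫ u in a..T, F u := by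
  rw [intervalIntegral.integral_of_le haT]
  refine setIntegral_eq_of_subset_of_forall_sdiff_eq_zero measurableSet_Ioi Ioc_subset_Ioi_self
    fun u hu => hF u ?_
  rw [Set.mem_sdiff, Set.mem_Ioi, Set.mem_Ioc, not_and, not_le] at hu
  exact hu.2 hu.1

/-- `∫_{u ≤ a} F = ∫_S^a F` when `F` vanishes below `S ≤ a` (inclusive). [folklore] -/
theorem setIntegral_Iic_eq_intervalIntegral {F : ℝ → ℝ} {S a : ℝ} (hSa : S ≤ a)
    (hF : ∀ u, u ≤ S → F u = 0) : ∫ u in Iic a, F u = ∫ u in S..a, F u := by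
  rw [intervalIntegral.integral_of_le hSa]
  refine setIntegral_eq_of_subset_of_forall_sdiff_eq_zero measurableSet_Iic Ioc_subset_Iic_self
    fun u hu => hF u ?_
  rw [Set.mem_sdiff, Set.mem_Iic, Set.mem_Ioc, not_and', not_lt] at hu
  exact hu.2 hu.1

/-- The per-`b` identity: for `c ≤ X + U₀ - 1`, `0 < U₀`, `2U₀ ≤ X`,
`∫ φ(c-u) u du - ∫_{U₀}^{X-U₀} ρ(u) u φ(c-u) du = ∫_{u ≤ U₀} φ(c-u) u du + ∫_{u > U₀} w♯(u) φ(c-u) u du`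
(`1 - 1_{[U₀,X-U₀]}ρ = 1_{u ≤ U₀} + 1_{u > U₀} w♯` on the support of `φ(c - ·)`).
[cite: TaoTeravainen2021, §8 (derivation of the expansion of `(χ∗log)♯` from (7.2), (7.3))] -/
theorem bump_moment_split {φ ψ : ℝ → ℝ} (hφ : IsBump φ) (hψ : IsSmoothCutoff ψ) {X U₀ : ℝ}
    (hU₀ : 0 < U₀) (hX : 2 * U₀ ≤ X) {c : ℝ} (hc : c ≤ X + U₀ - 1) :
    (∫ u, φ (c - u) * u) - ∫ u in U₀..(X - U₀), flatWeight ψ X U₀ u * u * φ (c - u) =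
      (∫ u in Iic U₀, φ (c - u) * u) + ∫ u in Ioi U₀, sharpWeight ψ X U₀ u * φ (c - u) * u := by
  have hXU : U₀ ≤ X - U₀ := by linarith
  have hint := hφ.integrable_sub_left_mul c
  set T : ℝ := X + U₀ with hT
  have hUT : U₀ ≤ T := by rw [hT]; linarith
  have hzero : ∀ u, T < u → φ (c - u) = 0 := fun u hu =>
    hφ.eq_zero _ (by rw [abs_of_nonpos (by rw [hT] at hu; linarith)]; rw [hT] at hu; linarith)
  -- `∫_ℝ = ∫_{≤ U₀} + ∫_{> U₀}`, and the `Ioi` integrals are integrals over `[U₀, T]`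
  rw [← intervalIntegral.integral_Iic_add_Ioi (b := U₀) hint.integrableOn hint.integrableOn,
    setIntegral_Ioi_eq_intervalIntegral hUT fun u hu => by rw [hzero u hu, zero_mul],
    setIntegral_Ioi_eq_intervalIntegral hUT fun u hu => by rw [hzero u hu, mul_zero, zero_mul],
    add_sub_assoc]
  congr 1
  -- continuity on `[U₀, T]` of the pieces
  have hcφ : Continuous fun u => φ (c - u) * u :=
    (hφ.continuous.comp (continuous_const.sub continuous_id)).mul continuous_id
  have hcw : Continuous (sharpWeight ψ X U₀) :=
    hψ.contDiff.continuous.comp ((continuous_const.sub continuous_id).div_const _)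
  have hρc : ContinuousOn (fun u => flatWeight ψ X U₀ u * u * φ (c - u)) (Set.uIcc U₀ (X - U₀)) := by
    rw [Set.uIcc_of_le hXU]
    refine (((continuousOn_flatWeight hψ X U₀).mono fun u hu => ?_).mul continuousOn_id).mul
      (hφ.continuous.comp (continuous_const.sub continuous_id)).continuousOn
    rw [Set.mem_Iic]; exact (Set.mem_Icc.mp hu).2.trans (by linarith)
  -- split `∫_{U₀}^T = ∫_{U₀}^{X-U₀} + ∫_{X-U₀}^T`
  have hXT : X - U₀ ≤ T := by rw [hT]; linarith
  have hcS : Continuous fun u => sharpWeight ψ X U₀ u * φ (c - u) * u :=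
    (hcw.mul (hφ.continuous.comp (continuous_const.sub continuous_id))).mul continuous_id
  rw [← intervalIntegral.integral_add_adjacent_intervals (b := X - U₀)
      (hcφ.intervalIntegrable _ _) (hcφ.intervalIntegrable _ _),
    ← intervalIntegral.integral_add_adjacent_intervals (b := X - U₀)
      (hcS.intervalIntegrable _ _) (hcS.intervalIntegrable _ _),
    add_sub_right_comm, ← intervalIntegral.integral_sub (hcφ.intervalIntegrable _ _) hρc.intervalIntegrable]
  congr 1
  · -- on `[U₀, X - U₀]`: `φu - ρuφ = (1-ρ)φu = w♯ φ u`
    refine intervalIntegral.integral_congr fun u hu => ?_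
    rw [Set.uIcc_of_le hXU, Set.mem_Icc] at hu
    rw [flatWeight_eq_of_le (by linarith [hu.2] : u ≤ X)]
    unfold sharpWeight; ring
  · -- on `[X - U₀, T]`: `w♯ = 1`
    refine intervalIntegral.integral_congr fun u hu => ?_
    rw [Set.uIcc_of_le hXT, Set.mem_Icc] at hu
    unfold sharpWeight
    rw [hψ.eq_one _ ?_, one_mul]
    rw [abs_le]; constructor
    · rw [le_div_iff₀ (by linarith)]; rw [hT] at hu; linarith [hu.2]
    · rw [div_le_iff₀ (by linarith)]; linarith [hu.1]

/-- **The three-term expansion of `(χ∗log)♯`** (`k = 2` bookkeeping): for `1 ≤ n` with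
`log n ≤ X + U₀ - 1`, `0 < U₀`, `2U₀ ≤ X`:
`(χ∗log)♯(n) = ∑_{db = n} χ(d) (c_b + Ψ(b))`
("`(χ∗log)♯(n) = ∑_{d∣n} (Ψ(n/d)χ(d) + c_d χ(n/d))`").
[cite: TaoTeravainen2021, §8 (the expansion of `(χ∗log)♯`)] -/
theorem sharpLog_eq_sum (χ : DirichletCharacter ℂ q) {φ ψ : ℝ → ℝ} (hφ : IsBump φ)
    (hψ : IsSmoothCutoff ψ) {X U₀ : ℝ} (hU₀ : 0 < U₀) (hX : 2 * U₀ ≤ X) {n : ℕ} (hn : 1 ≤ n)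
    (hnX : Real.log n ≤ X + U₀ - 1) :
    sharpLog χ φ ψ X U₀ n =
      ∑ p ∈ n.divisorsAntidiagonal, realChar χ p.1 * (sharpLogCoeff φ ψ X U₀ p.2 + psiSharp φ ψ X U₀ p.2) := by
  have hXU : U₀ ≤ X - U₀ := by linarith
  unfold sharpLog flatLog
  rw [charLog_eq_integral_hypK hφ χ n]
  change (∫ u, hypK χ φ u n * u) - ((∫ u in U₀..(X - U₀), flatWeight ψ X U₀ u * u * hypK χ φ u n) -
    flatKernel ψ X U₀ U₀ * hypK χ φ U₀ n) = _
  unfold hypK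
  -- push the sums out of the integrals
  have h1 : (∫ u, (∑ p ∈ n.divisorsAntidiagonal, realChar χ p.1 * φ (Real.log p.2 - u)) * u) =
      ∑ p ∈ n.divisorsAntidiagonal, realChar χ p.1 * ∫ u, φ (Real.log p.2 - u) * u := by
    simp_rw [sum_mul]
    rw [integral_finsetSum _ fun p _ => ?_]
    · refine sum_congr rfl fun p _ => ?_
      rw [← integral_const_mul]
      exact integral_congr_ae (Filter.Eventually.of_forall fun u => by simp only; ring)
    · have := (hφ.integrable_sub_left_mul (Real.log p.2)).const_mul (realChar χ p.1)
      exact this.congr (Filter.Eventually.of_forall fun u => by simp only; ring)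
  have h2 : (∫ u in U₀..(X - U₀), flatWeight ψ X U₀ u * u *
      ∑ p ∈ n.divisorsAntidiagonal, realChar χ p.1 * φ (Real.log p.2 - u)) =
      ∑ p ∈ n.divisorsAntidiagonal, realChar χ p.1 *
        ∫ u in U₀..(X - U₀), flatWeight ψ X U₀ u * u * φ (Real.log p.2 - u) := by
    simp_rw [mul_sum]
    rw [intervalIntegral.integral_finsetSum fun p _ => ?_]
    · refine sum_congr rfl fun p _ => ?_
      rw [← intervalIntegral.integral_const_mul]
      exact intervalIntegral.integral_congr fun u _ => by ring
    · refine ContinuousOn.intervalIntegrable ?_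
      rw [Set.uIcc_of_le hXU]
      refine (((continuousOn_flatWeight hψ X U₀).mono fun u hu => ?_).mul continuousOn_id).mul
        (continuous_const.mul (hφ.continuous.comp (continuous_const.sub continuous_id))).continuousOn
      rw [Set.mem_Iic]; exact (Set.mem_Icc.mp hu).2.trans (by linarith)
  rw [h1, h2, mul_sum, ← sum_sub_distrib, ← sum_sub_distrib]
  refine sum_congr rfl fun p hp => ?_
  have hb : 1 ≤ p.2 := Nat.pos_of_mem_divisors (Nat.snd_mem_divisors_of_mem_antidiagonal hp)
  have hbn : p.2 ≤ n := Nat.le_of_dvd (by omega) (Nat.dvd_of_mem_divisors (Nat.snd_mem_divisors_of_mem_antidiagonal hp))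
  have hc : Real.log p.2 ≤ X + U₀ - 1 :=
    (Real.log_le_log (by exact_mod_cast hb) (by exact_mod_cast hbn)).trans hnX
  have hsplit := bump_moment_split hφ hψ hU₀ hX hc
  unfold sharpLogCoeff psiSharp
  calc realChar χ p.1 * (∫ u, φ (Real.log p.2 - u) * u) -
        ((realChar χ p.1 * ∫ u in U₀..(X - U₀), flatWeight ψ X U₀ u * u * φ (Real.log p.2 - u)) -
        flatKernel ψ X U₀ U₀ * (realChar χ p.1 * φ (Real.log p.2 - U₀)))
      = realChar χ p.1 * ((∫ u, φ (Real.log p.2 - u) * u) -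
          ∫ u in U₀..(X - U₀), flatWeight ψ X U₀ u * u * φ (Real.log p.2 - u)) +
        flatKernel ψ X U₀ U₀ * (realChar χ p.1 * φ (Real.log p.2 - U₀)) := by ring
    _ = _ := by rw [hsplit]; ring


end TaoTeravainen

end Literature.Barriers.Parity
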